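import Summits.Ventures.PercRepro.Night2FatYGood

/-!
# night-2: the faces of a source whose line is a class line — no distance-1 load on a class line

A lossy big pair `Q′ = insert z B` (`|Q′ ∖ K| = |R| + 3`, `R` its rank-`2` line, three coloops) whose line `R` is
coplanar with the off-points `w₀, x` (`rk (R ∪ {w₀, x}) ≤ 3`) contains at most one of them (the line and the
coloops would have rank `≤ 4`); if it contains `u ∈ {w₀, x}` then the other off-point `p` lies in the closures of
BOTH faces `Q′ ∖ {c}` (`c` a coloop other than `u`): `p ∈ cl (R ∪ {u})`.  So `p` is in two thin-face closures
(`thinFacesOf_eq_image_erase`) and is NOT a good point (`notMem_gtPts_of_class_line`).  Consequence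
(`loaded_fat_target_dichotomy_class`): at a target containing both off-points a DISTANCE-1 load has
`rk (R ∪ {w₀, x}) ≥ 4` — its line is never a class line.  In the two-planes regime this kills every distance-1
load whose line is the spine or a class basis line through the pencil point.  Paper `proofs/NIGHT-2-g34.md` §6′.
-/

namespace PercRepro.Shadow

open PercRepro.ThmH PercRepro.PerFlat

variable {α : Type*} [DecidableEq α] {M : Matroid α} [M.Finite] {G : Finset α}

/-- **The off-point outside a class-line source is not a good point**: `Q′ = insert z B` lossy big with line
`R = (Q′ ∖ K) ∖ coloops (Q′ ∖ K)` coplanar with `w₀, x`, `u ∈ {w₀, x}` in `Q′`, `p` the other off-point outside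
`Q′`: `p` lies in the closures of the two faces `Q′ ∖ {c}`, `c ≠ u` a coloop, hence `p ∉ gtPts Q′`. -/
theorem notMem_gtPts_of_class_line (hG : G ∈ flatsQ M (5 + 1)) (hd : (gr M \ G).card = 2)
    (hk : kColoops M G = 1) (hs : ∀ e ∈ gr M, ∀ f ∈ gr M, e ≠ f → rkN M {e, f} = 2)
    (hl : ∀ e ∈ gr M, M.Indep {e}) {B₀ : Finset α} (hB₀ : B₀ ∈ thinMembers M 5 G) {w₀ x : α}
    (hD : G \ clF M B₀ = {w₀, x}) {B : Finset α} (hB : B ∈ thinMembers M 5 G)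
    (hbig : 5 ≤ (B \ coloops M G).card) {z : α} (hz : z ∈ G \ clF M B) (h : loss M 5 G B z ≠ 0)
    (hcls : rkN M (insert w₀ (insert x
      ((insert z B \ coloops M G) \ coloops M (insert z B \ coloops M G)))) ≤ 3)
    {u p : α} (huv : ({w₀, x} : Finset α) = {u, p}) (hu : u ∈ insert z B) (hp : p ∉ insert z B) :
    p ∉ gtPts M 5 G (insert z B) := by
  obtain ⟨hR2, hRcard⟩ := rkN_sdiff_coloops_eq_two_of_loss_ne_zero hG hd hk hs hl hB hbig hz h
  have hC3 := card_coloops_eq_three_of_loss_ne_zero hG hd hk hs hl hB hbig hz h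
  set Q := insert z B with hQ
  set C := coloops M (Q \ coloops M G) with hCdef
  set R := (Q \ coloops M G) \ C with hRdef
  have hGg : G ⊆ gr M := (mem_flatsQ.1 hG).1
  have hd' : (gr M \ G).card ≤ 5 := by omega
  have hQG : Q ⊆ G := Finset.insert_subset (Finset.mem_sdiff.1 hz).1 (subset_G_of_mem_thinMembers hB)
  have hKB : coloops M G ⊆ B := coloops_subset_of_mem_thinMembers hG hd' hB
  have hzB : z ∉ B := fun h' => (Finset.mem_sdiff.1 hz).2 (subset_clF_of_subset_gr
    ((subset_G_of_mem_thinMembers hB).trans hGg) h')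
  have hzK : z ∉ coloops M G := fun h' => hzB (hKB h')
  have hQ'6 : 6 ≤ (Q \ coloops M G).card := by
    have heq : Q \ coloops M G = insert z (B \ coloops M G) := by
      ext e
      simp only [hQ, Finset.mem_sdiff, Finset.mem_insert]
      constructor
      · rintro ⟨h' | h', h2⟩
        · exact Or.inl h'
        · exact Or.inr ⟨h', h2⟩
      · rintro (rfl | ⟨h', h2⟩)
        · exact ⟨Or.inl rfl, hzK⟩
        · exact ⟨Or.inr h', h2⟩
    rw [heq, Finset.card_insert_of_notMem (fun h' => hzB (Finset.mem_sdiff.1 h').1)]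
    omega
  have hR3 : 3 ≤ R.card := by omega
  have hRQ' : R ⊆ Q \ coloops M G := Finset.sdiff_subset
  have hRG : R ⊆ G := hRQ'.trans (Finset.sdiff_subset.trans hQG)
  -- the off-points: `p ∉ R` (it is outside `Q`), hence `u ∉ R`
  have hpR : p ∉ R := fun h' => hp (Finset.mem_sdiff.1 (hRQ' h')).1
  have huR : u ∉ R :=
    notMem_of_rkN_le_two_of_notMem hs hG hD hRG (by omega) hR3 huv hpR
  -- the two off-points are off the fat closure
  have hoffD : ∀ e, e ∈ ({w₀, x} : Finset α) → e ∈ G ∧ e ∉ clF M B₀ := by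
    intro e he
    rw [← hD] at he
    exact Finset.mem_sdiff.1 he
  have huD : u ∈ G ∧ u ∉ clF M B₀ := hoffD u (by rw [huv]; exact Finset.mem_insert_self _ _)
  have hpD : p ∈ G ∧ p ∉ clF M B₀ := hoffD p (by rw [huv]; exact Finset.mem_insert_of_mem (Finset.mem_singleton_self _))
  -- `R ⊆ clF B₀`: every point of `G` other than the off-points lies in the fat closure
  have hRB₀ : R ⊆ clF M B₀ := by
    intro r hr
    by_contra hr'
    have : r ∈ G \ clF M B₀ := Finset.mem_sdiff.2 ⟨hRG hr, hr'⟩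
    rw [hD, huv, Finset.mem_insert, Finset.mem_singleton] at this
    rcases this with rfl | rfl
    · exact huR hr
    · exact hpR hr
  have huK : u ∉ coloops M G := fun h' => huD.2 (subset_clF_of_subset_gr
    ((subset_G_of_mem_thinMembers hB₀).trans hGg) (coloops_subset_of_mem_thinMembers hG hd' hB₀ h'))
  -- `u` is a coloop of `Q ∖ K`
  have huC : u ∈ C := by
    have huQ' : u ∈ Q \ coloops M G := Finset.mem_sdiff.2 ⟨hu, huK⟩
    by_contra hc
    exact huR (Finset.mem_sdiff.2 ⟨huQ', hc⟩)
  -- two further coloops `c₁ ≠ c₂`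
  have hCe : (C.erase u).card = 2 := by rw [Finset.card_erase_of_mem huC, hC3]
  obtain ⟨c₁, c₂, hc12, hCe'⟩ := Finset.card_eq_two.1 hCe
  have hc₁ : c₁ ∈ C.erase u := by rw [hCe']; exact Finset.mem_insert_self _ _
  have hc₂ : c₂ ∈ C.erase u := by rw [hCe']; exact Finset.mem_insert_of_mem (Finset.mem_singleton_self _)
  have hc₁u : c₁ ≠ u := (Finset.mem_erase.1 hc₁).1
  have hc₂u : c₂ ≠ u := (Finset.mem_erase.1 hc₂).1
  have hc₁C : c₁ ∈ C := (Finset.mem_erase.1 hc₁).2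
  have hc₂C : c₂ ∈ C := (Finset.mem_erase.1 hc₂).2
  have hCQ' : C ⊆ Q \ coloops M G := by
    rw [hCdef]
    unfold coloops
    exact Finset.filter_subset _ _
  have hCQ : C ⊆ Q := fun c hc => (Finset.mem_sdiff.1 (hCQ' hc)).1
  have hCR : ∀ c ∈ C, c ∉ R := fun c hc hcR => (Finset.mem_sdiff.1 hcR).2 hc
  -- the faces `Q.erase c₁`, `Q.erase c₂` are thin faces
  have hfaces := thinFacesOf_eq_image_erase hG hd hk hs hl hB hbig hz h
  have hF : ∀ c ∈ C, Q.erase c ∈ thinFacesOf M 5 G Q := by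
    intro c hc
    rw [hfaces]
    exact Finset.mem_image_of_mem _ hc
  -- `p ∈ clF (insert u R)`: `rk (insert u R) = 3` and `rk (insert p (insert u R)) ≤ 3`
  have hrk3 : rkN M (insert u R) = 3 := by
    have : u ∉ clF M R := fun h' => huD.2 (clF_subset_clF_of_subset_clF hRB₀ h')
    rw [rkN_insert_of_notMem_clF (hGg huD.1) this, hR2]
  have hpcl : p ∈ clF M (insert u R) := by
    by_contra hpc
    have h4 := rkN_insert_of_notMem_clF (hGg hpD.1) hpc
    rw [hrk3] at h4
    have hle : rkN M (insert p (insert u R)) ≤ 3 := by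
      have heq : insert p (insert u R) = insert w₀ (insert x R) := by
        rw [Finset.insert_eq p, Finset.insert_eq u, ← Finset.union_assoc, Finset.insert_eq w₀,
          Finset.insert_eq x, ← Finset.union_assoc]
        congr 1
        rw [← Finset.insert_eq, ← Finset.insert_eq, huv, Finset.pair_comm]
      rw [heq]
      exact hcls
    omega
  have hpF : ∀ c ∈ C, c ≠ u → p ∈ clF M (Q.erase c) := by
    intro c hc hcu
    refine clF_mono ?_ hpcl
    intro e he
    rw [Finset.mem_insert] at he
    rw [Finset.mem_erase]
    rcases he with rfl | heR
    · exact ⟨hcu.symm, hu⟩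
    · exact ⟨fun h' => hCR c hc (h' ▸ heR), (Finset.mem_sdiff.1 (hRQ' heR)).1⟩
  -- two distinct thin faces whose closures contain `p`
  intro hgt
  have hcard : ({F ∈ thinFacesOf M 5 G Q | p ∈ clF M F} : Finset (Finset α)).card ≤ 1 := by
    unfold gtPts at hgt
    exact (Finset.mem_filter.1 hgt).2
  have hsub : ({Q.erase c₁, Q.erase c₂} : Finset (Finset α)) ⊆
      {F ∈ thinFacesOf M 5 G Q | p ∈ clF M F} := by
    intro F hF'
    rw [Finset.mem_insert, Finset.mem_singleton] at hF'
    rw [Finset.mem_filter]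
    rcases hF' with rfl | rfl
    · exact ⟨hF c₁ hc₁C, hpF c₁ hc₁C hc₁u⟩
    · exact ⟨hF c₂ hc₂C, hpF c₂ hc₂C hc₂u⟩
  have hne : Q.erase c₁ ≠ Q.erase c₂ := by
    intro heq
    have : c₂ ∈ Q.erase c₁ := Finset.mem_erase.2 ⟨hc12.symm, hCQ hc₂C⟩
    rw [heq] at this
    exact (Finset.mem_erase.1 this).1 rfl
  have := Finset.card_le_card hsub
  rw [Finset.card_pair hne] at this
  omega

/-- **The dichotomy with the class-line exclusion**: at a target `T ⊆ G` containing both off-points, a loaded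
`T` carries a rank-`2` line `R ⊆ (T ∖ K) ∖ {w₀, x}` with `|R| ≥ 3` and either `|R| + 4 = |T ∖ K|`, `rk (G ∖ T) ≥ 3`
and `rk (R ∪ {w₀, x}) ≥ 4` (a distance-1 load; its line is NOT a class line — the good point of its source would
lie in two thin-face closures, `notMem_gtPts_of_class_line`) or `|R| + 5 = |T ∖ K|` with `rk (R ∪ {w₀, x}) ≤ 3`
(a distance-2 load of a pair without good points). -/
theorem loaded_fat_target_dichotomy_class (hG : G ∈ flatsQ M (5 + 1)) (hd : (gr M \ G).card = 2)
    (hk : kColoops M G = 1) (hs : ∀ e ∈ gr M, ∀ f ∈ gr M, e ≠ f → rkN M {e, f} = 2)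
    (hl : ∀ e ∈ gr M, M.Indep {e}) (hfat : (fatClosures M 5 G 2).card ≤ 1) {B₀ : Finset α}
    (hB₀ : B₀ ∈ thinMembers M 5 G) {w₀ x : α} (hD : G \ clF M B₀ = {w₀, x}) (hne : w₀ ≠ x)
    {T : Finset α} (hTG : T ⊆ G) (hw₀T : w₀ ∈ T) (hxT : x ∈ T)
    (hload : dload M 5 G (bigP M G) (dshGT2 M 5 G) T ≠ 0) :
    ∃ R ⊆ (T \ coloops M G) \ {w₀, x}, rkN M R = 2 ∧ 3 ≤ R.card ∧
      ((R.card + 4 = (T \ coloops M G).card ∧ 3 ≤ rkN M (G \ T) ∧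
          4 ≤ rkN M (insert w₀ (insert x R))) ∨
        (R.card + 5 = (T \ coloops M G).card ∧ rkN M (insert w₀ (insert x R)) ≤ 3)) := by
  obtain ⟨B, hB, hbig, z, hz, hloss, hcase⟩ := exists_pair_of_dload_ne_zero' hG hd hk hs hl hfat hload
  obtain ⟨hR2, hRcard⟩ := rkN_sdiff_coloops_eq_two_of_loss_ne_zero hG hd hk hs hl hB hbig hz hloss
  have hcop : ¬ (gtPts M 5 G (insert z B)).Nonempty → rkN M (insert w₀ (insert x
      ((insert z B \ coloops M G) \ coloops M (insert z B \ coloops M G)))) ≤ 3 :=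
    fun hno => rkN_line_off_le_three_of_no_gtPts hG hd hk hs hl hB₀ hD hB hbig hz hloss hno
  obtain ⟨R, hRdef⟩ : ∃ R : Finset α,
      R = (insert z B \ coloops M G) \ coloops M (insert z B \ coloops M G) := ⟨_, rfl⟩
  rw [← hRdef] at hR2 hRcard hcop
  have hGg : G ⊆ gr M := (mem_flatsQ.1 hG).1
  have hd' : (gr M \ G).card ≤ 5 := by omega
  have hQG : insert z B ⊆ G :=
    Finset.insert_subset (Finset.mem_sdiff.1 hz).1 (subset_G_of_mem_thinMembers hB)
  have hKB : coloops M G ⊆ B := coloops_subset_of_mem_thinMembers hG hd' hB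
  have hKQ : coloops M G ⊆ insert z B := hKB.trans (Finset.subset_insert _ _)
  have hzB : z ∉ B := fun h' => (Finset.mem_sdiff.1 hz).2 (subset_clF_of_subset_gr
    ((subset_G_of_mem_thinMembers hB).trans hGg) h')
  have hzK : z ∉ coloops M G := fun h' => hzB (hKB h')
  have hQ'6 : 6 ≤ (insert z B \ coloops M G).card := by
    have heq : insert z B \ coloops M G = insert z (B \ coloops M G) := by
      ext e
      simp only [Finset.mem_sdiff, Finset.mem_insert]
      constructor
      · rintro ⟨h' | h', h2⟩
        · exact Or.inl h'
        · exact Or.inr ⟨h', h2⟩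
      · rintro (rfl | ⟨h', h2⟩)
        · exact ⟨Or.inl rfl, hzK⟩
        · exact ⟨Or.inr h', h2⟩
    rw [heq, Finset.card_insert_of_notMem (fun h' => hzB (Finset.mem_sdiff.1 h').1)]
    omega
  have hR3 : 3 ≤ R.card := by omega
  have hRQ' : R ⊆ insert z B \ coloops M G := by
    rw [hRdef]
    exact Finset.sdiff_subset
  have hRG : R ⊆ G := hRQ'.trans (Finset.sdiff_subset.trans hQG)
  have hoff := notMem_or_notMem_insert_of_loss_ne_zero hG hd hk hs hl hB₀ hD hB hbig hz hloss
  have hRoff : ∀ u v : α, ({w₀, x} : Finset α) = {u, v} → u ∉ insert z B → u ∉ R ∧ v ∉ R := by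
    intro u v huv huQ
    have huR : u ∉ R := fun h' => huQ (Finset.mem_sdiff.1 (hRQ' h')).1
    exact ⟨huR, notMem_of_rkN_le_two_of_notMem hs hG hD hRG (by omega) hR3
      (by rw [huv]; exact Finset.pair_comm _ _) huR⟩
  have hw₀x : w₀ ∉ R ∧ x ∉ R := by
    rcases hoff with h' | h'
    · exact hRoff w₀ x rfl h'
    · exact (hRoff x w₀ (Finset.pair_comm _ _) h').symm
  have h4 := four_le_rkN_sdiff_insert_of_loss_ne_zero hG hd hk hs hl hB hbig hz hloss
  rcases hcase with ⟨-, x', hx', rfl⟩ | ⟨hno, p, hp, rfl⟩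
  · obtain ⟨hx'G, hx'Q⟩ := Finset.mem_sdiff.1 (mem_goodPts.1 hx').1
    have hx'K : x' ∉ coloops M G := fun h' => hx'Q (hKQ h')
    refine ⟨R, ?_, hR2, hR3, Or.inl ⟨?_, ?_, ?_⟩⟩
    · intro r hr
      rw [Finset.mem_sdiff, Finset.mem_insert, Finset.mem_singleton]
      refine ⟨Finset.sdiff_subset_sdiff (Finset.subset_insert _ _) (Finset.Subset.refl _) (hRQ' hr), ?_⟩
      rintro (rfl | rfl)
      · exact hw₀x.1 hr
      · exact hw₀x.2 hr
    · have heq : insert x' (insert z B) \ coloops M G = insert x' (insert z B \ coloops M G) := by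
        ext e
        simp only [Finset.mem_sdiff, Finset.mem_insert]
        constructor
        · rintro ⟨h' | h', h2⟩
          · exact Or.inl h'
          · exact Or.inr ⟨h', h2⟩
        · rintro (rfl | ⟨h', h2⟩)
          · exact ⟨Or.inl rfl, hx'K⟩
          · exact ⟨Or.inr h', h2⟩
      rw [heq, Finset.card_insert_of_notMem (fun h' => hx'Q (Finset.mem_sdiff.1 h').1)]
      omega
    · have heq : G \ insert z B = insert x' (G \ insert x' (insert z B)) := by
        ext e
        simp only [Finset.mem_sdiff, Finset.mem_insert, not_or]
        constructor
        · rintro ⟨heG, heQ⟩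
          by_cases hex : e = x'
          · exact Or.inl hex
          · exact Or.inr ⟨heG, hex, heQ⟩
        · rintro (rfl | ⟨heG, -, heQ⟩)
          · refine ⟨hx'G, ?_⟩
            rwa [Finset.mem_insert, not_or] at hx'Q
          · exact ⟨heG, heQ⟩
      rw [heq] at h4
      have := rkN_insert_le_succ (M := M) (G \ insert x' (insert z B)) x'
      omega
    · -- the line of a distance-1 load is never a class line
      by_contra hcls
      have hcls' : rkN M (insert w₀ (insert x R)) ≤ 3 := by omega
      rw [hRdef] at hcls'
      rcases hoff with hw | hx
      · have hw' : w₀ = x' := by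
          rw [Finset.mem_insert] at hw₀T
          rcases hw₀T with h' | h'
          · exact h'
          · exact absurd h' hw
        have hxQ : x ∈ insert z B := by
          rw [Finset.mem_insert] at hxT
          rcases hxT with h' | h'
          · exact absurd (h'.trans hw'.symm).symm hne
          · exact h'
        have := notMem_gtPts_of_class_line hG hd hk hs hl hB₀ hD hB hbig hz hloss hcls'
          (u := x) (p := w₀) (Finset.pair_comm _ _) hxQ hw
        rw [hw'] at this
        exact this hx'
      · have hx'' : x = x' := by
          rw [Finset.mem_insert] at hxT
          rcases hxT with h' | h'
          · exact h'
          · exact absurd h' hx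
        have hwQ : w₀ ∈ insert z B := by
          rw [Finset.mem_insert] at hw₀T
          rcases hw₀T with h' | h'
          · exact absurd (h'.trans hx''.symm) hne
          · exact h'
        have := notMem_gtPts_of_class_line hG hd hk hs hl hB₀ hD hB hbig hz hloss hcls'
          (u := w₀) (p := x) rfl hwQ hx
        rw [hx''] at this
        exact this hx'
  · obtain ⟨⟨hp1, hp2⟩, hp12, -⟩ := mem_d2Pts.1 hp
    have hp1Q : p.1 ∉ insert z B := (Finset.mem_sdiff.1 hp1).2
    have hp2Q : p.2 ∉ insert z B := (Finset.mem_sdiff.1 hp2).2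
    have hp1K : p.1 ∉ coloops M G := fun h' => hp1Q (hKQ h')
    have hp2K : p.2 ∉ coloops M G := fun h' => hp2Q (hKQ h')
    refine ⟨R, ?_, hR2, hR3, Or.inr ⟨?_, hcop hno⟩⟩
    · intro r hr
      rw [Finset.mem_sdiff, Finset.mem_insert, Finset.mem_singleton]
      refine ⟨Finset.sdiff_subset_sdiff ((Finset.subset_insert _ _).trans (Finset.subset_insert _ _))
        (Finset.Subset.refl _) (hRQ' hr), ?_⟩
      rintro (rfl | rfl)
      · exact hw₀x.1 hr
      · exact hw₀x.2 hr
    · have heq : insert p.1 (insert p.2 (insert z B)) \ coloops M G =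
          insert p.1 (insert p.2 (insert z B \ coloops M G)) := by
        ext e
        simp only [Finset.mem_sdiff, Finset.mem_insert]
        constructor
        · rintro ⟨h' | h' | h', h2⟩
          · exact Or.inl h'
          · exact Or.inr (Or.inl h')
          · exact Or.inr (Or.inr ⟨h', h2⟩)
        · rintro (rfl | rfl | ⟨h', h2⟩)
          · exact ⟨Or.inl rfl, hp1K⟩
          · exact ⟨Or.inr (Or.inl rfl), hp2K⟩
          · exact ⟨Or.inr (Or.inr h'), h2⟩
      rw [heq, Finset.card_insert_of_notMem, Finset.card_insert_of_notMem
        (fun h' => hp2Q (Finset.mem_sdiff.1 h').1)]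
      · omega
      · rw [Finset.mem_insert, Finset.mem_sdiff]
        rintro (h' | ⟨h', -⟩)
        · exact hp12 h'
        · exact hp1Q h'

end PercRepro.Shadow
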